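import Summits.CriticalPhenomena.Ising3DConformalLimit.Theses.EnergyNotSigmaSquared
import Summits.CriticalPhenomena.Ising3DConformalLimit.Theorems.GapForcesFarMerging.Negative.ScaleIterationDyadic
import Summits.CriticalPhenomena.Ising3DConformalLimit.Theorems.EnergyNotSigmaSquaredGapForcesFarMergingRpUnpinch
import Summits.CriticalPhenomena.Ising3DConformalLimit.Theorems.EnergyNotSigmaSquaredGapForcesFarMergingSinglePinchPositive

/-!
# `GapForcesFarMerging` reduces to one-passage quasi-multiplicativity ALONE
(crux item stmt-CriticalPhenomena-4468, route `EnergyNotSigmaSquared`; line `rp-unpinch-single-passage`,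
lead prover-line-stmt-CriticalPhenomena-4468-0, 2026-08-16)

The checked skeleton of the line (`Cruxes/GapForcesFarMerging/Lines/rp-unpinch-single-passage.lean`) has
five registered stubs, stated over the shapes of `Negative.LineShapes` at the critical correlators
(`pairCovS`, `TS`, `NparS`, `avoidS`, `xR m = 2m e₁`, `up m = (2m,m,0)`, `dn m = (2m,-m,0)`, `mirror m`,
`src s = s e₂`; the `…Shape_criticalCorr_iff` lemmas there are `Iff.rfl`). Four of them are landed
theorems (namespace `…EnergyNotSigmaSquaredGapForcesFarMerging`): `stub_rpUnpinch` (the RP Gram minor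
through every site plane), `stub_unpinchedEnvelope`, `stub_singlePinchPositive`, `stub_scaleIteration`;
and the standing disprover's `Negative.ScaleIterationDyadic` proves
`gapForcesFarMerging_of_three_stubs(')`: the crux from the ISOSCELES RP minors `RPUnpinchIsoShape`,
strict single-pinch positivity and (dyadic, sub-exponential-defect) quasi-multiplicativity.

New here: the isosceles minors ARE instances of the landed stub 1 (`rpUnpinchIsoShape_criticalCorr`, via
`mirror m (up m) = m e₂`, `mirror m (dn m) = -m e₂`), so the crux is CLOSED MODULO THE SINGLE STATEMENT
`QuasiMultiplicativeShape cc2 (criticalCorr 3 4)` — one-passage quasi-multiplicativity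
`∃ c > 0, ∀ 1 ≤ s ≤ m/2, c · 𝒜(e₂; s) · 𝒜(s e₂; m) ≤ 𝒜(e₂; m)` of the normalised single-pinch avoidance
functional `𝒜(b; m) = ⟨σ₀σ_b ; σ_{up m}σ_{dn m}⟩ / (⟨σ₀σ_{dn m}⟩⟨σ_bσ_{up m}⟩)`
(`gapForcesFarMerging_of_quasiMultiplicative`, importable, no other hypothesis) — and even modulo its
dyadic weakening `QuasiMultiplicativeDyadicShape` (`gapForcesFarMerging_of_quasiMultiplicativeDyadic`).
GAP is consumed exactly once (`singlePinchLawShape_of_gap`). Quasi-multiplicativity is the crux's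
genuine content (`Negative.LineVerdicts.quasiMultiplicative_false_without_model`,
`Negative.quasiMultiplicativeDyadic_false_without_model`).

References: Fröhlich–Israel–Lieb–Simon 1978 (reflection positivity) [FILS1978]; Aizenman 1982
[AizenmanCMP1982]; Aizenman–Duminil-Copin 2021 [AizenmanDuminilCopinAnnals2021]; Lawler 1991, ch. 3–5
(quasi-multiplicativity of non-intersection probabilities, the model statement) [Lawler1991].
-/

noncomputable section

namespace Summit.CriticalPhenomena.Ising3DConformalLimit.EnergyNotSigmaSquaredGapForcesFarMerging

open Literature.Probability.LatticeModels
open Summit.CriticalPhenomena.Ising3DConformalLimit.Theses.EnergyNotSigmaSquared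
open Summit.CriticalPhenomena.Ising3DConformalLimit.Theorems.GapForcesFarMerging.Negative
  (e₁ e₂ cc2 FarMergingShape xR up dn mirror src pairCovS TS NparS avoidS RPUnpinchShape RPUnpinchIsoShape
    SinglePinchLawShape SinglePinchPositiveShape QuasiMultiplicativeShape QuasiMultiplicativeDyadicShape
    singlePinchLaw_of_gap_and_isoRP gapForcesFarMerging_of_three_stubs gapForcesFarMerging_of_three_stubs')

/-! ## The landed stubs 1 and 3 in the vocabulary of `Negative.LineShapes` (definitional repackaging) -/

/-- Stub 1 of the line, landed: the RP Gram minor `RPUnpinchShape` — all site mirrors, all far-side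
targets — holds for the critical correlators (`stub_rpUnpinch`; `rpUnpinchShape_criticalCorr_iff` is
`Iff.rfl`). [cite: FILS1978, Thm. 2.1] -/
theorem rpUnpinchShape_criticalCorr : RPUnpinchShape cc2 (criticalCorr 3 4) :=
  (Theorems.GapForcesFarMerging.Negative.rpUnpinchShape_criticalCorr_iff).2 stub_rpUnpinch

/-- Stub 3 of the line, landed: strict single-pinch positivity `SinglePinchPositiveShape` holds for the
critical correlators (`stub_singlePinchPositive`). [folklore] -/
theorem singlePinchPositiveShape_criticalCorr : SinglePinchPositiveShape cc2 (criticalCorr 3 4) :=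
  (Theorems.GapForcesFarMerging.Negative.singlePinchPositiveShape_criticalCorr_iff).2 stub_singlePinchPositive

/-! ## The isosceles instances of the RP minor -/

/-- The mirror image of `up m = (2m,m,0)` through the site plane `{x₀ = m}` is `m e₂`. [folklore] -/
theorem mirror_up (m : ℕ) : mirror m (up m) = Pi.single 1 (m : ℤ) := by
  ext i; fin_cases i <;> simp [mirror, up, xR]; ring

/-- The mirror image of `dn m = (2m,-m,0)` through the site plane `{x₀ = m}` is `-m e₂`. [folklore] -/
theorem mirror_dn (m : ℕ) : mirror m (dn m) = Pi.single 1 (-(m : ℤ)) := by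
  ext i; fin_cases i <;> simp [mirror, dn, xR]; ring

/-- `(up m)₀ = 2m`. [folklore] -/
theorem up_apply_zero (m : ℕ) : up m 0 = 2 * (m : ℤ) := by simp [up, xR]

/-- `(dn m)₀ = 2m`. [folklore] -/
theorem dn_apply_zero (m : ℕ) : dn m 0 = 2 * (m : ℤ) := by simp [dn, xR]

/-- **The isosceles RP minors hold for the critical state**: for every `m ≥ 1`,
`⟨ε₀ ; σ_{up m}σ_{dn m}⟩² ≤ ⟨ε₀ ; ε_{2me₁}⟩ · ⟨σ_{me₂}σ_{-me₂} ; σ_{up m}σ_{dn m}⟩` — the instances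
`y = up m`, `z = dn m` of the landed stub 1 (their mirror images are `±m e₂`). These are the only RP
inputs the line consumes. [cite: FILS1978, Thm. 2.1] -/
theorem rpUnpinchIsoShape_criticalCorr : RPUnpinchIsoShape cc2 (criticalCorr 3 4) := by
  intro m _hm
  have h := rpUnpinchShape_criticalCorr m (up m) (dn m) (by rw [up_apply_zero]; omega)
    (by rw [dn_apply_zero]; omega)
  rwa [mirror_up, mirror_dn] at h

/-! ## The reduction -/

/-- GAP ⟹ the single-pinch law with exponent `κ/2` for the critical state, unconditionally in the RP
input (the disprover's `singlePinchLaw_of_gap_and_isoRP` with the isosceles minors discharged). GAP is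
consumed here and only here in the line. [folklore] -/
theorem singlePinchLawShape_of_gap (hGAP : EnergyGapPowerLaw) :
    SinglePinchLawShape cc2 (criticalTwoPoint 3) (criticalCorr 3 4) :=
  singlePinchLaw_of_gap_and_isoRP rpUnpinchIsoShape_criticalCorr hGAP

/-- **The crux reduces to DYADIC quasi-multiplicativity with sub-exponential defect** (the weakest
form the iteration consumes): `QuasiMultiplicativeDyadicShape cc2 (criticalCorr 3 4) → GapForcesFarMerging`,
with the isosceles RP minors and strict positivity discharged by the landed stubs 1 and 3. [folklore] -/
theorem gapForcesFarMerging_of_quasiMultiplicativeDyadic :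
    QuasiMultiplicativeDyadicShape cc2 (criticalCorr 3 4) → GapForcesFarMerging :=
  fun h4 => gapForcesFarMerging_of_three_stubs rpUnpinchIsoShape_criticalCorr
    singlePinchPositiveShape_criticalCorr h4

/-- **The crux reduces to quasi-multiplicativity alone** (kernel-checked composition of the line
`rp-unpinch-single-passage` with its four landed stubs): one-passage quasi-multiplicativity of the
normalised single-pinch avoidance functional `𝒜(b; m)` of the critical Ising model on `ℤ³` implies
`GapForcesFarMerging`. [folklore] -/
theorem gapForcesFarMerging_of_quasiMultiplicative :
    QuasiMultiplicativeShape cc2 (criticalCorr 3 4) → GapForcesFarMerging :=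
  fun h4 => gapForcesFarMerging_of_three_stubs' rpUnpinchIsoShape_criticalCorr
    singlePinchPositiveShape_criticalCorr h4

end Summit.CriticalPhenomena.Ising3DConformalLimit.EnergyNotSigmaSquaredGapForcesFarMerging

end
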